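import Summits.RiemannHypothesis.RiemannHypothesis.Theorems.HandoffDodgerAsymptoticsA
import HarnessLib

/-!
# HANDOFF — ASYMPTOTICS (B): sizes of the deficit constant, the power-sum sandwich and the window (rh-explicit, track «HANDOFF», seat prove-2 gen10, ATTEMPT-19 §8 (P3)–(P4))

HONEST FRAMING. Nothing here bears on the truth of RH; elementary real analysis (Mathlib + part (A)). With the horizon of part (A)
(`T₀ = 2πe^{1+2b}`, `s = s₁(T₀)`, `k′`, `T′ = πk′/b`) DEFINE the explicit quantities of `dodger_witness_explicit`:
`dodgerTprime b = T′`, `dodgerCI b = (T′ − π(3s+5)/b − 1)³/(18π) − (log T₀ + ⅓)/(6π) − (s+1)(T′−1)²/2`, `dodgerPL b = 2·cI − k′/4`,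
`dodgerW b = T′² + ¼`, `dodgerPU b = k′·W`, and prove for `b ≥ 60`: `T₀/1.01 ≤ T′ ≤ T₀`, `e^{2b} ≤ T′`, `T′³/(19π) ≤ cI ≤ T′³`,
`4cI ≥ 1024`, `pL ≥ T′³/(10π)`, `0 < pU ≤ (41/100)·b·T′³`, `T′² ≤ W ≤ (101/100)T′²`, `2 ≤ k′ ≤ (2/5)bT′`.
No `sorry`, standard axioms.

References: this track (ATTEMPT-16 §3 Lemma B2, §6.1; ATTEMPT-19 §8).
-/

set_option linter.dupNamespace false

noncomputable section

open Real

namespace Summit.RiemannHypothesis.RiemannHypothesis.Theorems.Handoff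

/-- `T′(b) = πk′/b`. [this track, ATTEMPT-16 §1] -/
def dodgerTprime (b : ℝ) : ℝ := π * (dodgerKprime b) / b

/-- The explicit lower bound `cI` for the deficit integral `∫₀^{T′} t·D`. [this track, ATTEMPT-19 §8 (P3)] -/
def dodgerCI (b : ℝ) : ℝ :=
  (dodgerTprime b - π * (3 * (0.1038 * Real.log (dodgerT₀ b) + 0.2573 * Real.log (Real.log (dodgerT₀ b)) + 9.3675 : ℝ) + 5) / b - 1) ^ 3 / (18 * π) - (Real.log (dodgerT₀ b) + 1 / 3) / (6 * π) -
    ((0.1038 * Real.log (dodgerT₀ b) + 0.2573 * Real.log (Real.log (dodgerT₀ b)) + 9.3675 : ℝ) + 1) * (dodgerTprime b - 1) ^ 2 / 2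

/-- `W(b) = T′² + ¼`. [this track, ATTEMPT-19 §3] -/
def dodgerW (b : ℝ) : ℝ := dodgerTprime b ^ 2 + 1 / 4

/-- The explicit lower bound `pL = 2cI − k′/4` for `p₁`. [this track, ATTEMPT-19 §8 (P4)] -/
def dodgerPL (b : ℝ) : ℝ := 2 * dodgerCI b - (dodgerKprime b : ℝ) / 4

/-- The explicit upper bound `pU = k′·W` for `p₁`. [this track, ATTEMPT-19 §8 (P4)] -/
def dodgerPU (b : ℝ) : ℝ := (dodgerKprime b : ℝ) * dodgerW b

/-- **Sizes for `b ≥ 60`.** `T₀ ≤ 1.01T′`, `T′ ≤ T₀`, `e^{2b} ≤ T′`, `3600 ≤ T′`, `T′³/(19π) ≤ cI ≤ T′³`, `1024 ≤ 4cI`,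
`T′³/(10π) ≤ pL`, `0 < pU ≤ (41/100)·b·T′³`, `T′² ≤ W ≤ (101/100)T′²`, `2 ≤ k′ ≤ (2/5)·b·T′`. [this track, ATTEMPT-19 §8] -/
theorem horizon_sizes_B {b : ℝ} (hb : 60 ≤ b) :
    dodgerT₀ b ≤ 101 / 100 * dodgerTprime b ∧ dodgerTprime b ≤ dodgerT₀ b ∧ Real.exp (2 * b) ≤ dodgerTprime b ∧
    3600 ≤ dodgerTprime b ∧
    dodgerTprime b ^ 3 / (19 * π) ≤ dodgerCI b ∧ dodgerCI b ≤ dodgerTprime b ^ 3 ∧ 1024 ≤ 4 * dodgerCI b ∧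
    dodgerTprime b ^ 3 / (10 * π) ≤ dodgerPL b ∧
    0 < dodgerPU b ∧ dodgerPU b ≤ 41 / 100 * b * dodgerTprime b ^ 3 ∧
    dodgerTprime b ^ 2 ≤ dodgerW b ∧ dodgerW b ≤ 101 / 100 * dodgerTprime b ^ 2 ∧
    (2 : ℝ) ≤ (dodgerKprime b : ℝ) ∧ (dodgerKprime b : ℝ) ≤ 2 / 5 * b * dodgerTprime b := by
  obtain ⟨hT₀e, hT₀ge, hs9, hsb⟩ := horizon_sizes hb
  obtain ⟨hside, -⟩ := horizon_side_conditions hb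
  obtain ⟨hA, hB, hT3, hk2, hℓ2, hK1, hAT₀⟩ := horizon_index_bounds hb
  have hπ3 : 3 < π := Real.pi_gt_three
  have hπ4 : π < 3.15 := Real.pi_lt_d2
  have hπ := Real.pi_pos
  have hb0 : 0 < b := by linarith
  have hbb : 60 * b ≤ b ^ 2 := by nlinarith
  set T₀ := dodgerT₀ b with hT₀
  set s := (0.1038 * Real.log (dodgerT₀ b) + 0.2573 * Real.log (Real.log (dodgerT₀ b)) + 9.3675 : ℝ) with hs
  have hTs : dodgerTstar b = T₀ - 4 * π * (s + 2) := rfl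
  rw [hTs] at hA hB
  have hT'def : dodgerTprime b = π * (dodgerKprime b) / b := rfl
  set T' := dodgerTprime b with hT'
  rw [← hT'def] at hA hB hT3 hℓ2 hAT₀
  set k : ℝ := (dodgerKprime b : ℝ) with hk
  have hπb : π / b ≤ 1 := by rw [div_le_one hb0]; linarith
  -- `T₀ ≤ 1.2 T′`
  have h1 : T₀ ≤ 6 / 5 * T' := by linarith only [hside, hB, hπb, hT₀ge, hbb, hb]
  have hT'pos : 0 < T' := by nlinarith only [h1, hT₀ge, hb]
  -- `e^{2b} ≤ T′`: `T₀ = 2πe·e^{2b} ≥ 6e^{2b}` and `T′ ≥ T₀/1.2`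
  have hexp2b : Real.exp (2 * b) ≤ T' := by
    have e : T₀ = 2 * π * Real.exp 1 * Real.exp (2 * b) := by
      rw [hT₀, dodgerT₀, Real.exp_add]; ring
    have hc : (6 : ℝ) / 5 ≤ 2 * π * Real.exp 1 := by
      have := Real.exp_one_gt_d9; nlinarith only [this, hπ3]
    have h2 : 6 / 5 * Real.exp (2 * b) ≤ T₀ := by rw [e]; exact mul_le_mul_of_nonneg_right hc (Real.exp_pos _).le
    linarith only [h1, h2]
  have hexp3 : (2 * b) ^ 3 / 6 ≤ Real.exp (2 * b) := by
    have := Real.pow_div_factorial_le_exp (2 * b) (by linarith : (0:ℝ) ≤ 2 * b) 3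
    norm_num [Nat.factorial] at this; exact this
  have hb3 : 3600 * b ≤ b ^ 3 := by nlinarith only [hbb, hb]
  have hT'b : 700 * (b + 1) ≤ T' := by nlinarith only [hexp3, hexp2b, hb3, hb]
  have hT'600 : 600 * b ≤ T' := by linarith only [hT'b, hb]
  have hT'3600 : 3600 ≤ T' := by nlinarith only [hT'600, hb]
  have hT'4800 : 4800 * b ≤ T' := by nlinarith only [hexp3, hexp2b, hb3]
  -- `T₀ ≤ 1.01 T′`
  have h101 : T₀ ≤ 101 / 100 * T' := by
    have h4πs : 4 * π * (s + 2) ≤ 12.6 * (b + 2) := by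
      have := mul_nonneg (by linarith only [hπ4] : (0:ℝ) ≤ 3.15 - π) (by linarith only [hs9] : (0:ℝ) ≤ s + 2)
      nlinarith only [this, hsb, hπ3]
    linarith only [hB, hπb, h4πs, hT'4800, hb]
  -- `k′ = bT′/π ≤ 0.4 b T′`
  have hkT : k = b * T' / π := by rw [hT'def]; field_simp
  have hk04 : k ≤ 2 / 5 * b * T' := by
    rw [hkT, div_le_iff₀ hπ]
    have := mul_nonneg hb0.le hT'pos.le
    nlinarith only [this, hπ3]
  have hk0 : 0 ≤ k := by rw [hk]; exact Nat.cast_nonneg _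
  -- `cI ≥ T′³/(24π)`
  have hlogT₀ : Real.log T₀ ≤ 2 * b + 8 := by
    have : Real.log T₀ = Real.log (2 * π) + 1 + 2 * b := by
      rw [hT₀, dodgerT₀, Real.log_mul (by positivity) (Real.exp_pos _).ne', Real.log_exp]; ring
    have hl2π : Real.log (2 * π) ≤ 2 * π - 1 := Real.log_le_sub_one_of_pos (by positivity)
    linarith only [this, hl2π, hπ4]
  have hlogT₀0 : 0 ≤ Real.log T₀ := by
    have : (1:ℝ) ≤ T₀ := by have := Real.exp_one_gt_d9; linarith only [this, hT₀e]
    exact Real.log_nonneg this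
  have ha : π * (3 * s + 5) / b + 1 ≤ T' / 100 := by
    have hps : π * (3 * s + 5) ≤ 3.15 * (3 * b + 5) := by
      have := mul_nonneg (by linarith only [hπ4] : (0:ℝ) ≤ 3.15 - π) (by linarith only [hs9] : (0:ℝ) ≤ 3 * s + 5)
      nlinarith only [this, hsb, hπ3]
    have : π * (3 * s + 5) / b ≤ (12 * b + 20) / 60 := by
      rw [div_le_div_iff₀ hb0 (by norm_num)]
      nlinarith only [hps, hbb, hb]
    linarith only [this, hT'600, hb]
  have hcube : (99 / 100 * T') ^ 3 ≤ (T' - π * (3 * s + 5) / b - 1) ^ 3 :=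
    pow_le_pow_left₀ (by positivity) (by linarith only [ha]) 3
  have hsq : (s + 1) * (T' - 1) ^ 2 / 2 ≤ (b + 1) * T' ^ 2 / 2 := by
    have h2 : (T' - 1) ^ 2 ≤ T' ^ 2 := by nlinarith only [hT'3600]
    have h3 : (s + 1) * (T' - 1) ^ 2 ≤ (b + 1) * T' ^ 2 :=
      mul_le_mul (by linarith only [hsb]) h2 (sq_nonneg _) (by linarith only [hb])
    linarith only [h3]
  have hcI : T' ^ 3 / (19 * π) ≤ dodgerCI b := by
    rw [dodgerCI, ← hT', ← hs, ← hT₀]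
    have h4 : (Real.log T₀ + 1 / 3) / (6 * π) ≤ b := by
      rw [div_le_iff₀ (by positivity)]
      have : 18 * b ≤ b * (6 * π) := by nlinarith only [hπ3, hb0]
      linarith only [this, hlogT₀, hb]
    have h5 : (99 / 100 * T') ^ 3 / (18 * π) ≤ (T' - π * (3 * s + 5) / b - 1) ^ 3 / (18 * π) :=
      div_le_div_of_nonneg_right hcube (by positivity)
    -- `T′³/(19π) + b + (b+1)T′²/2 ≤ (0.99T′)³/(18π)`
    have hd : (99 / 100 * T') ^ 3 / (18 * π) - T' ^ 3 / (19 * π) = 435681 / 342000000 * T' ^ 3 / π := by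
      ring
    have h72 : 435681 / 342000000 * T' ^ 3 / 3.15 ≤ 435681 / 342000000 * T' ^ 3 / π :=
      div_le_div_of_nonneg_left (by positivity) (by positivity) hπ4.le
    have hT2 : 0 ≤ T' ^ 2 := sq_nonneg _
    have hT3e : T' ^ 3 = T' * T' ^ 2 := by ring
    have p1 : 4800 * b * T' ^ 2 ≤ T' ^ 3 := by
      rw [hT3e]; exact mul_le_mul_of_nonneg_right hT'4800 hT2
    have p2 : (1 : ℝ) ≤ T' ^ 2 := by nlinarith only [hT'3600]
    have p3 : b ≤ b * T' ^ 2 := by nlinarith only [p2, hb0]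
    have key : T' ^ 3 / (19 * π) + b + (b + 1) * T' ^ 2 / 2 ≤ (99 / 100 * T') ^ 3 / (18 * π) := by
      have : b + (b + 1) * T' ^ 2 / 2 ≤ 435681 / 342000000 * T' ^ 3 / 3.15 := by
        rw [le_div_iff₀ (by norm_num)]
        nlinarith only [p1, p3, hb0, hT2, hb]
      linarith only [this, hd, h72]
    linarith only [key, h4, h5, hsq]
  have hcI2 : dodgerCI b ≤ T' ^ 3 := by
    rw [dodgerCI, ← hT', ← hs, ← hT₀]
    have ha0 : 0 ≤ π * (3 * s + 5) / b + 1 := by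
      have : 0 ≤ π * (3 * s + 5) / b := div_nonneg (by nlinarith only [hπ, hs9]) hb0.le
      linarith only [this]
    have hc3 : (T' - π * (3 * s + 5) / b - 1) ^ 3 ≤ T' ^ 3 :=
      pow_le_pow_left₀ (by linarith only [ha, hT'pos]) (by linarith only [ha0]) 3
    have h1 : (T' - π * (3 * s + 5) / b - 1) ^ 3 / (18 * π) ≤ T' ^ 3 / (18 * π) :=
      div_le_div_of_nonneg_right hc3 (by positivity)
    have h2 : T' ^ 3 / (18 * π) ≤ T' ^ 3 := by
      rw [div_le_iff₀ (by positivity)]; nlinarith only [pow_pos hT'pos 3, hπ3]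
    have hX : 0 ≤ (Real.log T₀ + 1 / 3) / (6 * π) := div_nonneg (by linarith only [hlogT₀0]) (by positivity)
    have hY : 0 ≤ (s + 1) * (T' - 1) ^ 2 / 2 :=
      div_nonneg (mul_nonneg (by linarith only [hs9]) (sq_nonneg _)) (by norm_num)
    linarith only [h1, h2, hX, hY]
  have hcL : 1024 ≤ 4 * dodgerCI b := by
    have : T' ^ 3 / (19 * π) ≥ 256 := by
      rw [ge_iff_le, le_div_iff₀ (by positivity)]
      have h3 := pow_le_pow_left₀ (by norm_num : (0:ℝ) ≤ 3600) hT'3600 3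
      nlinarith only [h3, hπ4]
    linarith only [this, hcI]
  have hpL : T' ^ 3 / (10 * π) ≤ dodgerPL b := by
    rw [dodgerPL, ← hk]
    have : k / 4 ≤ b * T' / 10 := by linarith only [hk04]
    have h2 : T' ^ 3 / (10 * π) + b * T' / 10 ≤ 2 * (T' ^ 3 / (19 * π)) := by
      have h3 : 2 * (T' ^ 3 / (19 * π)) - T' ^ 3 / (10 * π) = T' ^ 3 / (190 * π) := by ring
      have h4 : b * T' / 10 ≤ T' ^ 3 / (190 * π) := by
        rw [div_le_div_iff₀ (by norm_num) (by positivity)]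
        have hT3e : T' ^ 3 = T' * T' ^ 2 := by ring
        have p1 : 600 * b * T' ^ 2 ≤ T' ^ 3 := by rw [hT3e]; exact mul_le_mul_of_nonneg_right hT'600 (sq_nonneg T')
        have p2 : 3600 * T' ≤ T' ^ 2 := by nlinarith only [hT'3600]
        have p3 := mul_le_mul_of_nonneg_left p2 (by positivity : (0:ℝ) ≤ 600 * b)
        have p5 : b * T' * (190 * π) ≤ b * T' * 599 := by nlinarith only [hπ4, mul_nonneg hb0.le hT'pos.le]
        nlinarith only [p1, p3, p5, hb0, hT'pos]
      linarith only [h3, h4]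
    linarith only [this, h2, hcI]
  have hW : dodgerW b ≤ 101 / 100 * T' ^ 2 := by
    rw [dodgerW, ← hT']; nlinarith only [hT'3600]
  have hW1 : T' ^ 2 ≤ dodgerW b := by rw [dodgerW, ← hT']; linarith only []
  have hk2' : (2 : ℝ) ≤ k := by rw [hk]; exact_mod_cast hk2
  have hpU : dodgerPU b ≤ 41 / 100 * b * T' ^ 3 := by
    rw [dodgerPU, ← hk]
    calc k * dodgerW b ≤ 2 / 5 * b * T' * (101 / 100 * T' ^ 2) :=
          mul_le_mul hk04 hW (by rw [dodgerW]; positivity) (by positivity)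
      _ ≤ 41 / 100 * b * T' ^ 3 := by nlinarith only [mul_nonneg hb0.le (pow_pos hT'pos 3).le]
  have hpU0 : 0 < dodgerPU b := by
    rw [dodgerPU, ← hk]; exact mul_pos (by linarith only [hk2']) (by rw [dodgerW]; positivity)
  exact ⟨h101, hAT₀, hexp2b, hT'3600, hcI, hcI2, hcL, hpL, hpU0, hpU, hW1, hW, hk2', hk04⟩

end Summit.RiemannHypothesis.RiemannHypothesis.Theorems.Handoff

end
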